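import Summits.BirchSwinnertonDyer.BirchSwinnertonDyer.Theorems.Rank2Observatory2DescClRealCurveCertS
import HarnessLib

/-!
# BirchSwinnertonDyer — rank ≥ 2 observatory: KERNEL-2DESC-CL v3.0 — the SPLIT-2 per-curve checker (totally real case) with an EXTRA SIEVE CONJUNCT (`…RSX`)

HONEST FRAMING: per-curve certified theorems and census instruments; no claim on BSD in rank ≥ 2.

The host-side half of the NODAL LOCAL-IMAGE ROW on the landed totally real split-2 stack `…ClRealCurveCertS{Defs,}`
(fields in which `2` is totally split and no second order `ℤ[η]` exists; totally real cubic `F`): the core clauses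
`checkRSCore` (= `checkRS r` without its survivor count) and **`rank_le_of_checkRSX`** — the landed soundness theorem
`rank_le_of_checkRS` generalised ONCE by an extra admissibility conjunct `extra U` on the sieve, with its pointwise
soundness stated over the characterising equations of `e = θ_E` and of the family `W` (`m₁·e = lin X_t`,
`m₁·W_j = lin X_j`, `W_j ≠ 0`, `F(e) = 0`, `y ≠ 0` at the rational point), and the survivor count of `admRS ∧ extra`
bounded by `2 ^ r`.  The proof is the landed proof of `rank_le_of_checkRS` verbatim except at the three places the
conjunct enters (empty set, the rational point, the count) — the same surgery as the landed `…ClRealCertE2X`.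
Nodal consumer: `…ClRealCurveCertSN`.  New declarations only.
Sorry-free; axioms `propext`, `Classical.choice`, `Quot.sound`.
[cite: Cassels1991LecturesEllipticCurves, §15] [cite: CremonaAlgorithms1997, §3.6] [cite: Cohen1993, §6.5]
[cite: Marcus2018, Ch. 5, Thm. 38]
-/

set_option linter.dupNamespace false

noncomputable section

open scoped Classical NumberField nonZeroDivisors

open Literature.NumberTheory.NumberFields Polynomial Module NumberField IsDedekindDomain Ideal

namespace Summit.BirchSwinnertonDyer.BirchSwinnertonDyer.Rank2Observatory.TwoDescCl

open TwoDescCubic ClFieldCert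

section Checkers

variable (G : ClFieldCertRS2) (ccr : ClCurveCertSR)

/-- The CORE clauses of the totally real split-2 per-curve checker: `checkRS r` without its final survivor count
(curve side, fractional generator views, support dispatch, codes, three-sign family, place order, independence
certificate). -/
def checkRSCore : Bool :=
  decide (deltaShort ccr.cc.A ccr.cc.B ccr.cc.C ≠ 0) &&
    noRootMod ccr.cc.pF ccr.cc.A ccr.cc.B ccr.cc.C &&
    decide (cubicAtCoords G.toS2.fs.base.a G.toS2.fs.base.b G.toS2.fs.base.c ((G.toS2.m₁ : ℤ) * ccr.cc.A)
      ((G.toS2.m₁ : ℤ) ^ 2 * ccr.cc.B) ((G.toS2.m₁ : ℤ) ^ 3 * ccr.cc.C) ccr.cc.Xt = (0, 0, 0)) &&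
    decide (derivAtCoords G.toS2.fs.base.a G.toS2.fs.base.b G.toS2.fs.base.c ((G.toS2.m₁ : ℤ) * ccr.cc.A)
      ((G.toS2.m₁ : ℤ) ^ 2 * ccr.cc.B) ccr.cc.Xt =
      MonicCubic.mulCoords G.toS2.fs.base.a G.toS2.fs.base.b G.toS2.fs.base.c
        (smulCoords (G.toS2.m₁ : ℤ) ccr.cc.XD)
        (prodPowCoords G.toS2.fs.base.a G.toS2.fs.base.b G.toS2.fs.base.c [])) &&
    (fracOf G.toS2 ccr.cc.Xt ccr.cc.tsnT).check G.toS2.fs.base.a G.toS2.fs.base.b G.toS2.fs.base.c &&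
    (fracOf G.toS2 ccr.cc.XD ccr.cc.tsnD).check G.toS2.fs.base.a G.toS2.fs.base.b G.toS2.fs.base.c &&
    decide (0 < MonicCubic.disc ccr.cc.A ccr.cc.B ccr.cc.C) &&
    decide (normFormZ G.toS2.fs.base.a G.toS2.fs.base.b G.toS2.fs.base.c ccr.cc.XD.1 ccr.cc.XD.2.1
      ccr.cc.XD.2.2 ≠ 0) &&
    decide ((normFormZ G.toS2.fs.base.a G.toS2.fs.base.b G.toS2.fs.base.c ccr.cc.XD.1 ccr.cc.XD.2.1
      ccr.cc.XD.2.2).natAbs = (ccr.cc.dn.map fun pe => pe.1 ^ pe.2).prod) &&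
    (ccr.cc.dn.all fun pe => primeDispatchS G.toS2 ccr.cc (fracOf G.toS2 ccr.cc.XD ccr.cc.tsnD) ccr.cc.XD
      ccr.cc.dinvA ccr.cc.dmiss2 pe.1) &&
    (ccr.cc.codes.all fun bc => codeClauseS G.toS2 ccr.cc bc) &&
    invCert G.toS2.fs.base.a G.toS2.fs.base.b G.toS2.fs.base.c G.toS2.fs.base.w₁ ccr.cc.XD ccr.cc.dW1 &&
    invCert G.toS2.fs.base.a G.toS2.fs.base.b G.toS2.fs.base.c G.toS2.fs.base.w₂ ccr.cc.XD ccr.cc.dW2 &&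
    (ccr.cc.Q.all fun q => decide (0 < q)) &&
    decide (ccr.cc.head.length = 5) &&
    ((famS ccr.cc).all fun f => famCheckSR G ccr f) &&
    (linLtCond (G.fr.I ccr.o₀).1 (G.fr.I ccr.o₀).2 (G.fr.I ccr.o₁).1 (G.fr.I ccr.o₁).2 ccr.cc.Xt &&
      linLtCond (G.fr.I ccr.o₁).1 (G.fr.I ccr.o₁).2 (G.fr.I ccr.o₂).1 (G.fr.I ccr.o₂).2 ccr.cc.Xt) &&
    decide (∀ T : Finset (Fin (famS ccr.cc).length), T ≠ ∅ →
      ∃ k : Fin (G.toS2.fs.base.chars.length + 5), Odd (T.filter fun j => bitRS G ccr k j = true).card)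

end Checkers

section Sound

variable {K : Type*} [Field K] [NumberField K] {θ : K}

/-- **Soundness of the totally real split-2 checker with an extra sieve conjunct: `rank E(ℚ) ≤ r`.**
The core clauses `checkRSCore`, an extra conjunct `extra` sound at rational points (hypothesis `hextra`), and the
count of survivors of `admRS ∧ extra`. [cite: Cassels1991LecturesEllipticCurves, §15] [cite: CremonaAlgorithms1997, §3.6] -/
theorem rank_le_of_checkRSX (r : ℕ) (G : ClFieldCertRS2)
    (hθ : aeval θ (MonicCubic.poly G.toS2.fs.base.a G.toS2.fs.base.b G.toS2.fs.base.c) = 0)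
    (h3 : finrank ℚ K = 3) (h2 : G.check2RS = true) (hpr : G.toS2.fs.base.primeList.Forall Nat.Prime)
    (ccr : ClCurveCertSR) (hc : checkRSCore G ccr = true)
    (extra : Finset (Fin (famS ccr.cc).length) → Bool) (hextra0 : extra ∅ = true)
    (hextra : ∀ (e : 𝓞 K) (W : Fin (famS ccr.cc).length → 𝓞 K),
      (G.toS2.m₁ : 𝓞 K) * e = lin hθ ccr.cc.Xt.1 ccr.cc.Xt.2.1 ccr.cc.Xt.2.2 →
      (∀ j, (G.toS2.m₁ : 𝓞 K) * W j =
        lin hθ ((famS ccr.cc).get j).X.1 ((famS ccr.cc).get j).X.2.1 ((famS ccr.cc).get j).X.2.2) →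
      (∀ j, W j ≠ 0) → e ^ 3 + ccr.cc.A * e ^ 2 + ccr.cc.B * e + ccr.cc.C = 0 →
      ∀ x y : ℚ, y ^ 2 = x ^ 3 + ccr.cc.A * x ^ 2 + ccr.cc.B * x + ccr.cc.C → y ≠ 0 →
      ∀ U : Finset (Fin (famS ccr.cc).length),
        IsSquare ((algebraMap ℚ K x - algebraMap (𝓞 K) K e) * ∏ j ∈ U, algebraMap (𝓞 K) K (W j)) →
        extra U = true)
    (hcount : ((Finset.univ ×ˢ Finset.univ).filter
      (fun p : Finset (Fin 0) × Finset (Fin (famS ccr.cc).length) =>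
        (admRS G ccr p.1 p.2 && extra p.2) = true)).card ≤ 2 ^ r) :
    ((⟨0, ccr.cc.A, 0, ccr.cc.B, ccr.cc.C⟩ : WeierstrassCurve ℚ)).mordellWeilRank ≤ r := by
  classical
  have hK := G.const_of_check2RS h2
  have harch := G.checkArch_of_check2RS h2
  have hS := G.coreS_of_check2RS h2
  have hR := G.toS2.fs.checkReg_of_coreS hS
  have hirr := G.toS2.fs.base.irreducible_of_reg hR
  have h0 := G.fr.lo_nonneg_of_arch harch
  have hq := G.toS2.fs.base.q_prime hpr
  simp only [checkRSCore, Bool.and_eq_true, decide_eq_true_eq, List.all_eq_true] at hc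
  obtain ⟨⟨⟨⟨⟨⟨⟨⟨⟨⟨⟨⟨⟨⟨⟨⟨⟨hΔ, hirrF⟩, hcub⟩, hder⟩, htX⟩, htD⟩, hdisc⟩, hND0⟩, hdn⟩, hdnC⟩, hcodes⟩, hdW1⟩,
    hdW2⟩, hQ⟩, hhead⟩, hfamAll⟩, hord⟩, hcert⟩ := hc
  haveI hEl := isElliptic_of_deltaShort_ne hΔ
  have hirrF' := irreducible_of_noRootMod hirrF
  have hm₁K : (G.toS2.m₁ : K) ≠ 0 := m₁S_ne_zero_K hK
  have hm₁O : (G.toS2.m₁ : 𝓞 K) ≠ 0 := m₁S_ne_zero_O hK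
  -- `θ_E = e₀`, root of `F`
  set eT : 𝓞 K := (fracOf G.toS2 ccr.cc.Xt ccr.cc.tsnT).toInt hθ htX with heT
  set eD : 𝓞 K := (fracOf G.toS2 ccr.cc.XD ccr.cc.tsnD).toInt hθ htD with heD
  have hXe := m₁_mul_eltS_coe hθ htX
  have haevX := aeval_lin_eq_zero_of_coords hθ ccr.cc.Xt hcub
  have haev : aeval (algebraMap (𝓞 K) K eT) (MonicCubic.poly ccr.cc.A ccr.cc.B ccr.cc.C) = 0 := by
    rw [← hXe] at haevX
    simp only [MonicCubic.poly, map_add, map_mul, map_pow, aeval_X, eq_intCast, map_intCast, map_natCast]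
      at haevX ⊢
    have h3' : (G.toS2.m₁ : K) ^ 3 ≠ 0 := pow_ne_zero 3 hm₁K
    apply mul_right_injective₀ h3'
    simp only [mul_zero]
    linear_combination haevX
  -- `D₀ = F′(e₀)`
  have hderX := deriv_eq_of_coords hθ ccr.cc.Xt (smulCoords (G.toS2.m₁ : ℤ) ccr.cc.XD) [] hder
  have hderiv : (3 : 𝓞 K) * eT ^ 2 + 2 * ((ccr.cc.A : ℤ) : 𝓞 K) * eT + ((ccr.cc.B : ℤ) : 𝓞 K) = eD := by
    rw [lin_smulCoords, ← m₁_mul_eltS hθ htX, ← m₁_mul_eltS hθ htD] at hderX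
    simp only [List.map_nil, List.prod_nil, mul_one, Int.cast_mul, Int.cast_pow, Int.cast_natCast] at hderX
    have h2' : (G.toS2.m₁ : 𝓞 K) ^ 2 ≠ 0 := pow_ne_zero 2 hm₁O
    apply mul_right_injective₀ h2'
    simp only
    linear_combination hderX
  have hD0 : eD ≠ 0 := eltS_ne_zero hθ h3 hS htD hND0
  have hq0 : ((G.toS2.fs.base.q : ℕ) : 𝓞 K) ≠ 0 := by exact_mod_cast hq.ne_zero
  have hM0 : eD * ((G.toS2.fs.base.q : ℕ) : 𝓞 K) ≠ 0 := mul_ne_zero hD0 hq0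
  have hgen := closure_tsupp_eq_top_of_dvd
    (dvd_mul_left ((G.toS2.fs.base.q : ℕ) : 𝓞 K) eD) (G.toS2.fs.closure_q_eq_top_of_coreS hθ h3 hS hpr)
  have hDM : ∀ v : HeightOneSpectrum (𝓞 K), (3 : 𝓞 K) * eT ^ 2 + 2 * ((ccr.cc.A : ℤ) : 𝓞 K) * eT +
      ((ccr.cc.B : ℤ) : 𝓞 K) ∈ v.asIdeal → eD * ((G.toS2.fs.base.q : ℕ) : 𝓞 K) ∈ v.asIdeal := by
    intro v hv
    rw [hderiv] at hv
    exact Ideal.mul_mem_right _ _ hv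
  -- `D₀ ∉ W₁, W₂` (read on `X_D`)
  have hXD_W₁ : lin hθ ccr.cc.XD.1 ccr.cc.XD.2.1 ccr.cc.XD.2.2 ∉ (G.toS2.fs.base.W₁r hθ h3 hR hpr).asIdeal :=
    lin_not_mem_of_invCert hθ _ (W₁r_asIdeal hθ h3 hR hpr) hdW1
  have hXD_W₂ : lin hθ ccr.cc.XD.1 ccr.cc.XD.2.1 ccr.cc.XD.2.2 ∉ (G.toS2.fs.base.W₂r hθ h3 hR hpr).asIdeal :=
    lin_not_mem_of_invCert hθ _ (W₂r_asIdeal hθ h3 hR hpr) hdW2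
  have hDW₁ : eD ∉ (G.toS2.fs.base.W₁r hθ h3 hR hpr).asIdeal := fun h =>
    hXD_W₁ (by rw [← m₁_mul_eltS hθ htD]; exact Ideal.mul_mem_left _ _ h)
  have hDW₂ : eD ∉ (G.toS2.fs.base.W₂r hθ h3 hR hpr).asIdeal := fun h =>
    hXD_W₂ (by rw [← m₁_mul_eltS hθ htD]; exact Ideal.mul_mem_left _ _ h)
  -- the support `T = {W₁, W₂} ∪ code primes`
  set L := ccr.cc.codes.length with hL
  let Tf : Fin (L + 2) → HeightOneSpectrum (𝓞 K) := Matrix.vecCons (G.toS2.fs.base.W₁r hθ h3 hR hpr)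
    (Matrix.vecCons (G.toS2.fs.base.W₂r hθ h3 hR hpr) fun i => codePrimeS G.toS2 hθ h3 hS hpr (ccr.cc.codes.get i))
  have hT : ∀ w : HeightOneSpectrum (𝓞 K), eD * ((G.toS2.fs.base.q : ℕ) : 𝓞 K) ∈ w.asIdeal → ∃ i, Tf i = w := by
    intro w hw
    have hqw : ((G.toS2.fs.base.q : ℕ) : 𝓞 K) ∈ w.asIdeal → ∃ i, Tf i = w := fun hqw => by
      rcases eq_W₁r_or_W₂r hθ h3 hR hpr w hqw with rfl | rfl
      · exact ⟨0, by simp [Tf]⟩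
      · exact ⟨1, by simp [Tf]⟩
    rcases w.isPrime.mem_or_mem hw with hD | hq'
    · have hXv : lin hθ ccr.cc.XD.1 ccr.cc.XD.2.1 ccr.cc.XD.2.2 ∈ w.asIdeal := by
        rw [← m₁_mul_eltS hθ htD]; exact Ideal.mul_mem_left _ _ hD
      obtain ⟨pe, hpe, hpv⟩ := exists_prime_of_memS hθ h3 hS hND0 hdn w hXv
      rcases dispatch_soundS (cc := ccr.cc) hθ h3 hS hK hpr htD (m₁_mul_eltS hθ htD) (hdnC pe hpe) w hpv hD with
        hq'' | ⟨C, hmem, hany, hC, hw', -⟩ | ⟨i, hmem, hw'⟩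
      · exact hqw hq''
      · obtain ⟨bc, hbc, hbc1⟩ := List.mem_map.mp hmem
        obtain ⟨i, hi⟩ := List.mem_iff_get.mp hbc
        refine ⟨i.succ.succ, HeightOneSpectrum.ext ?_⟩
        simp only [Tf, Matrix.cons_val_succ]
        rw [hi, codePrimeS, if_pos (by rw [hbc1]), show bc.1.2 = C by rw [hbc1],
          codePrimeR_asIdeal hθ h3 hR hpr hany hC, hw']
      · obtain ⟨bc, hbc, hbc1⟩ := List.mem_map.mp hmem
        obtain ⟨i₀, hi₀⟩ := List.mem_iff_get.mp hbc
        refine ⟨i₀.succ.succ, ?_⟩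
        simp only [Tf, Matrix.cons_val_succ]
        rw [hi₀, hw']
        have hb1 : bc.1.1 = false := by rw [hbc1]
        have hb2 : bc.1.2.1 = (i : ℕ) := by rw [hbc1]
        unfold codePrimeS
        rw [if_neg (by rw [hb1]; exact Bool.false_ne_true), dif_pos (by rw [hb2]; exact i.isLt)]
        congr 1
        exact Fin.ext hb2
    · exact hqw hq'
  -- the family (`famS ccr.cc` written out: the binders `extra`, `hextra`, `hcount` mention it)
  have hfam : ∀ j : Fin (famS ccr.cc).length, famCheckSR G ccr ((famS ccr.cc).get j) = true := fun j => hfamAll _ (List.get_mem _ j)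
  have hfam1 : ∀ j : Fin (famS ccr.cc).length, famCheckS G.toS2 ccr.cc ((famS ccr.cc).get j) = true :=
    fun j => famCheckS_of_famCheckSR (hfam j)
  let W : Fin (famS ccr.cc).length → 𝓞 K := fun j =>
    (fracOf G.toS2 ((famS ccr.cc).get j).X ((famS ccr.cc).get j).tsn).toInt hθ (frac_of_famCheckS (hfam1 j))
  have hW0 : ∀ j, W j ≠ 0 := fun j => eltS_ne_zero hθ h3 hS _ (normFormZ_ne_of_famCheckS (hfam1 j))
  have hWval : ∀ j (v : HeightOneSpectrum (𝓞 K)), eD * ((G.toS2.fs.base.q : ℕ) : 𝓞 K) ∉ v.asIdeal →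
      v.valuation K (algebraMap (𝓞 K) K (W j)) = 1 :=
    fun j v hv => valuation_eq_one_of_support _ _ (supp_of_famCheckS hθ h3 hS hK hpr hcodes htD (hfam1 j)) v hv
  obtain ⟨ρ, hρ⟩ := G.fr.exists_rho_of_arch hθ h3 hR harch
  have hsg : ∀ (k : Fin 3) (j : Fin (famS ccr.cc).length),
      (sgAtS ccr ((famS ccr.cc).get j) k = true ↔ ρ k (algebraMap (𝓞 K) K (W j)) < 0) :=
    fun k j => sgAtS_iff_of_famCheckSR hθ ρ h0 hρ hK (hfam j) k
  have hρ0 : ∀ (k : Fin 3) (j : Fin (famS ccr.cc).length), ρ k (algebraMap (𝓞 K) K (W j)) ≠ 0 :=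
    fun k j => rho_ne_zero_of_famCheckSR hθ ρ h0 hρ (hfam j) k
  -- independence modulo squares: the parity certificate (rows computed on `X = m₁ x`, `m₁` a square)
  have hind : ∀ S : Finset (Fin (famS ccr.cc).length), IsSquare (∏ i ∈ S, algebraMap (𝓞 K) K (W i)) → S = ∅ := by
    intro S hSq
    refine indep_of_parity_certificate (fun i => algebraMap (𝓞 K) K (W i)) (bitRS G ccr) ?_ hcert S hSq
    intro k S' hS'
    have hS'' : IsSquare (∏ i ∈ S', W i) := isSquare_prod_of_isSquare_prod_coe _ hS'
    have hreal : ∀ kk : Fin 3,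
        Even (S'.filter fun i => sgAtS ccr ((famS ccr.cc).get i) kk = true).card := fun kk => by
      have h := even_card_of_isSquare_real (ρ kk) (fun i => algebraMap (𝓞 K) K (W i)) (fun i => hρ0 kk i) hS'
      convert h using 2
      exact Finset.filter_congr (fun i _ => hsg kk i)
    obtain ⟨k, hk⟩ := k
    rcases k with _ | _ | _ | _ | _ | k
    · simpa [bitRS, bitRowRS, sgAtS] using hreal 0
    · simpa [bitRS, bitRowRS, sgAtS] using hreal 1
    · simpa [bitRS, bitRowRS, sgAtS] using hreal 2
    · exact even_card_of_isSquare_valuation (G.toS2.fs.base.W₁r hθ h3 hR hpr) W hW0 _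
        (fun i => by
          show ((!decide ((2 : ℤ) ∣ famL₁S ((famS ccr.cc).get i))) = true ↔ _)
          rw [log_W₁_of_famCheckS hθ h3 hS hK hpr (hfam1 i)]; simp) hS'
    · exact even_card_of_isSquare_valuation (G.toS2.fs.base.W₂r hθ h3 hR hpr) W hW0 _
        (fun i => by
          show ((!decide ((2 : ℤ) ∣ famL₂S ((famS ccr.cc).get i))) = true ↔ _)
          rw [log_W₂_of_famCheckS hθ h3 hS hK hpr (hfam1 i)]; simp) hS'
    · have hk' : k < G.toS2.fs.base.chars.length := by omega
      have hch : G.toS2.fs.base.chars.getD k ((3 : ℕ), (0 : ℤ), (0 : ℤ)) ∈ G.toS2.fs.base.chars := by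
        rw [List.getD_eq_getElem?_getD, List.getElem?_eq_getElem hk', Option.getD_some]
        exact List.getElem_mem hk'
      obtain ⟨h2', ψ, hψ⟩ := G.toS2.fs.base.exists_psi_of_reg hθ h3 hR hpr hch
      haveI : Fact (G.toS2.fs.base.chars.getD k (3, 0, 0)).1.Prime := ⟨G.toS2.fs.base.char_prime hpr hch⟩
      have hSX : IsSquare (∏ i ∈ S', lin hθ ((famS ccr.cc).get i).X.1 ((famS ccr.cc).get i).X.2.1 ((famS ccr.cc).get i).X.2.2) := by
        have e1 : ∀ i ∈ S', lin hθ ((famS ccr.cc).get i).X.1 ((famS ccr.cc).get i).X.2.1 ((famS ccr.cc).get i).X.2.2 = (G.toS2.m₁ : 𝓞 K) * W i :=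
          fun i _ => (m₁_mul_eltS hθ (frac_of_famCheckS (hfam1 i))).symm
        rw [Finset.prod_congr rfl e1, Finset.prod_mul_distrib, Finset.prod_const]
        obtain ⟨z, hz⟩ := hS''
        refine ⟨(G.toS2.r₁ : 𝓞 K) ^ S'.card * z, ?_⟩
        rw [hz]
        simp only [ClFieldCertS2.m₁, Nat.cast_pow]
        ring
      have h := even_card_filter_eulerBit hθ (ℓ := (G.toS2.fs.base.chars.getD k (3, 0, 0)).1) (by omega) ψ hψ
        (fun i => ((famS ccr.cc).get i).X) (fun i => not_dvd_evalInt_of_famCheckS (hfam1 i) hch) hSX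
      convert h using 2
      exact Finset.filter_congr (fun i _ => Iff.rfl)
  -- spanning of the `T`-units modulo squares
  have hodd : Odd (finrank ℚ K) := by rw [h3]; decide
  have hn : (famS ccr.cc).length = NumberField.Units.rank K + 1 + (L + 2) := by
    rw [G.fr.units_rank_of_arch hθ h3 hR harch]
    simp only [famS, List.length_append, List.length_map, hL, hhead]
    omega
  have hspan : ∀ u : K, u ≠ 0 →
      (∀ v : HeightOneSpectrum (𝓞 K), eD * ((G.toS2.fs.base.q : ℕ) : 𝓞 K) ∉ v.asIdeal → v.valuation K u = 1) →
      ∃ U : Finset (Fin (famS ccr.cc).length), IsSquare (u * ∏ j ∈ U, algebraMap (𝓞 K) K (W j)) :=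
    fun u hu huT => exists_isSquare_tunit_mul_prod hodd _ Tf hT hn (fun j => algebraMap (𝓞 K) K (W j))
      (fun j => RingOfIntegers.coe_ne_zero_iff.mpr (hW0 j)) hWval hind u hu huT
  -- the sieve is sound at rational points
  have hθQ : ∀ x : ℚ, algebraMap ℚ K x ≠ algebraMap (𝓞 K) K eT :=
    ne_of_powIndep (powIndep_algebraMap hirrF' haev h3)
  have hFrel : eT ^ 3 + ccr.cc.A * eT ^ 2 + ccr.cc.B * eT + ccr.cc.C = 0 := by
    apply RingOfIntegers.coe_injective
    simpa only [map_add, map_mul, map_pow, map_intCast, _root_.map_zero] using MonicCubic.theta_rel haev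
  -- the `θ_E`-order of the places, read on `X_t = m₁·e₀` (`m₁ > 0`)
  have hmR : (0 : ℝ) < G.toS2.m₁ := Nat.cast_pos.mpr (G.toS2.m₁_pos hK)
  have h12 : ρ ccr.o₀ (algebraMap (𝓞 K) K eT) < ρ ccr.o₁ (algebraMap (𝓞 K) K eT) := by
    have h := lin_lt_lin hθ (ρ ccr.o₀) (ρ ccr.o₁) (h0 _) (hρ _).1 (hρ _).2 (h0 _) (hρ _).1 (hρ _).2 _ _ _
      (of_decide_eq_true hord.1)
    rw [rho_eltS hθ htX (ρ ccr.o₀), rho_eltS hθ htX (ρ ccr.o₁)] at h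
    exact lt_of_mul_lt_mul_left h hmR.le
  have h23 : ρ ccr.o₁ (algebraMap (𝓞 K) K eT) < ρ ccr.o₂ (algebraMap (𝓞 K) K eT) := by
    have h := lin_lt_lin hθ (ρ ccr.o₁) (ρ ccr.o₂) (h0 _) (hρ _).1 (hρ _).2 (h0 _) (hρ _).1 (hρ _).2 _ _ _
      (of_decide_eq_true hord.2)
    rw [rho_eltS hθ htX (ρ ccr.o₁), rho_eltS hθ htX (ρ ccr.o₂)] at h
    exact lt_of_mul_lt_mul_left h hmR.le
  have hadm0 : (admRS G ccr ∅ ∅ && extra ∅) = true := by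
    simp only [admRS, Bool.and_eq_true, decide_eq_true_eq, Finset.filter_empty, Finset.card_empty]
    exact ⟨⟨⟨admStd3RQ_empty _ hQ _ _ _ _ _ _ _ _, by decide⟩, by decide⟩, hextra0⟩
  -- `y ≠ 0` at rational points (`F` irreducible of degree `3` has no rational root)
  have hy0 : ∀ x y : ℚ, y ^ 2 = x ^ 3 + ccr.cc.A * x ^ 2 + ccr.cc.B * x + ccr.cc.C → y ≠ 0 := by
    intro x y hxy hy
    rw [hy] at hxy
    have hroot : (MonicCubic.polyQ ccr.cc.A ccr.cc.B ccr.cc.C).IsRoot x := by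
      rw [MonicCubic.polyQ_eq, Polynomial.IsRoot.def]
      simp only [eval_add, eval_mul, eval_pow, eval_X, eval_C]
      linear_combination -hxy
    have h1 : (MonicCubic.polyQ ccr.cc.A ccr.cc.B ccr.cc.C).natDegree = 1 :=
      Polynomial.natDegree_eq_of_degree_eq_some (Polynomial.degree_eq_one_of_irreducible_of_root hirrF' hroot)
    have h3' : (MonicCubic.polyQ ccr.cc.A ccr.cc.B ccr.cc.C).natDegree = 3 :=
      MonicCubic.natDegree_polyQ ccr.cc.A ccr.cc.B ccr.cc.C
    omega
  have hadm : ∀ x y : ℚ, y ^ 2 = x ^ 3 + ccr.cc.A * x ^ 2 + ccr.cc.B * x + ccr.cc.C →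
      ∀ (T : Finset (Fin 0)) (U : Finset (Fin (famS ccr.cc).length)),
        IsSquare ((algebraMap ℚ K x - algebraMap (𝓞 K) K eT) *
          (∏ i ∈ T, algebraMap (𝓞 K) K (((fun i : Fin 0 => i.elim0 : Fin 0 → (𝓞 K)ˣ) i : (𝓞 K)ˣ) : 𝓞 K)) *
            ∏ j ∈ U, algebraMap (𝓞 K) K (W j)) → (admRS G ccr T U && extra U) = true := by
    intro x y hxy T U hsq
    have hT0 : T = ∅ := Finset.eq_empty_of_isEmpty T
    have hxU : extra U = true := by
      refine hextra _ W (m₁_mul_eltS hθ htX) (fun j => m₁_mul_eltS hθ (frac_of_famCheckS (hfam1 j)))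
        hW0 hFrel x y hxy (hy0 x y hxy) U ?_
      rw [hT0, Finset.prod_empty, mul_one] at hsq
      exact hsq
    have h1 : admStd3R (fun i : Fin 0 => i.elim0) (famNormS G.toS2 ccr.cc) (fun i : Fin 0 => i.elim0)
        (fun i : Fin 0 => i.elim0) (fun i : Fin 0 => i.elim0) (fun j => sgAtS ccr ((famS ccr.cc).get j) ccr.o₀)
        (fun j => sgAtS ccr ((famS ccr.cc).get j) ccr.o₁) (fun j => sgAtS ccr ((famS ccr.cc).get j) ccr.o₂) T U = true :=
      admStd3R_sound hirrF' haev h3 (ρ ccr.o₀) (ρ ccr.o₁) (ρ ccr.o₂) h12 h23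
        (w := fun i : Fin 0 => algebraMap (𝓞 K) K
          (((fun i : Fin 0 => i.elim0 : Fin 0 → (𝓞 K)ˣ) i : (𝓞 K)ˣ) : 𝓞 K))
        (g := fun j => algebraMap (𝓞 K) K (W j)) (fun i => i.elim0)
        (fun j => RingOfIntegers.coe_ne_zero_iff.mpr (hW0 j)) (fun i => i.elim0)
        (fun j => norm_eltS hθ h3 hS hK (frac_of_famCheckS (hfam1 j)) (dvd_of_famCheckS (hfam1 j)))
        (fun i => i.elim0) (fun i => i.elim0) (fun i => i.elim0)
        (fun j => hsg _ j) (fun j => hsg _ j) (fun j => hsg _ j) x y hxy T U hsq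
    have h2'' := valRow_sound hFrel hθQ (G.toS2.fs.base.W₁r hθ h3 hR hpr) (by rw [hderiv]; exact hDW₁) hW0
      (r := fun j => bitRowRS ccr G.toS2.fs.base ((famS ccr.cc).get j) 3) (fun j => by
        show ((!decide ((2 : ℤ) ∣ famL₁S ((famS ccr.cc).get j))) = true ↔ _)
        rw [show algebraMap (𝓞 K) K (W j) = ((W j : 𝓞 K) : K) from rfl,
          log_W₁_of_famCheckS hθ h3 hS hK hpr (hfam1 j)]; simp) x y hxy T U hsq
    have h3'' := valRow_sound hFrel hθQ (G.toS2.fs.base.W₂r hθ h3 hR hpr) (by rw [hderiv]; exact hDW₂) hW0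
      (r := fun j => bitRowRS ccr G.toS2.fs.base ((famS ccr.cc).get j) 4) (fun j => by
        show ((!decide ((2 : ℤ) ∣ famL₂S ((famS ccr.cc).get j))) = true ↔ _)
        rw [show algebraMap (𝓞 K) K (W j) = ((W j : 𝓞 K) : K) from rfl,
          log_W₂_of_famCheckS hθ h3 hS hK hpr (hfam1 j)]; simp) x y hxy T U hsq
    simp only [admRS, Bool.and_eq_true]
    exact ⟨⟨⟨admStd3RQ_of_admStd3R hQ h1, h2''⟩, h3''⟩, hxU⟩
  exact mordellWeilRank_le_of_coverSet_cl (A := ccr.cc.A) (B := ccr.cc.B) (C := ccr.cc.C)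
    (⟨0, ccr.cc.A, 0, ccr.cc.B, ccr.cc.C⟩ : WeierstrassCurve ℚ) rfl rfl rfl rfl rfl hirrF' haev h3 hM0 hgen hDM
    hW0 hspan (Wu := fun i : Fin 0 => i.elim0) (adm := fun T U => admRS G ccr T U && extra U) hadm0 hadm
    (s' := r) hcount

end Sound

end Summit.BirchSwinnertonDyer.BirchSwinnertonDyer.Rank2Observatory.TwoDescCl

end
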